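import Summits.AtomisticToContinuum.HydrodynamicLimit.Theorems.InformationPercolationEngineCollisionRate
import Summits.AtomisticToContinuum.HydrodynamicLimit.Theorems.EvenStressEnskog.Negative.SwappedOrderTrivial
import Summits.AtomisticToContinuum.HydrodynamicLimit.Theorems.EvenStressEnskog.Negative.ContactValueZero
import Summits.AtomisticToContinuum.HydrodynamicLimit.Theorems.EvenStressEnskog.Negative.TwoStreamTexture
import Literature.Analysis.FluidPDE.HardSphereTorusMeasure

/-!
# Disproof of `CollisionRate` — standing adversary's work file (crux stmt-AtomisticToContinuum-13481)

Crux `Summit.AtomisticToContinuum.HydrodynamicLimit.Theses.InformationPercolationEngine.CollisionRate` (route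
InformationPercolationEngine, rank 9; verbatim re-filing of stmt-3988): the ENSKOG COLLISION-FREQUENCY LAW for
deterministic hard spheres at fixed reduced density — `K_N[χ g(σ³ρ_r)] − σ³∫₀^τ∫ χ g(σ³ρ_r) Y(σ³ρ_r) B¹_r → 0` in
local-Gibbs probability, `N → ∞` at fixed `r`, then `r → 0`; `B¹_r = ∫∫ b_r b_r π‖v − w‖ d(μ⊗μ)`,
`Y = (3/2π)·deriv hsExcessFreeEnergy`.  By the tree bridge `Theorems.CollisionRate.collisionRate_iff_evenStat_one`
(prover s2) the crux statistic is `evenStat σ N Φ τ χ g (fun _ => 1) r` — the CONSTANT-MARK instance of the sibling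
crux `JParityClosure.EvenStressEnskog` (stmt-13079), whose standing Disproof (`Cruxes/EvenStressEnskog/Disproof.lean`,
cycles 1–2) and six landed `Theorems/EvenStressEnskog/Negative/*.lean` lemmas are quantified over an ARBITRARY mark and
therefore apply here verbatim at `Ξ ≡ 1`.  This file records what is specific to the collision COUNT and to the picked
line `Sketch`; it does not repeat the sibling's junk audit (cited in §4).

## Findings — cycle 1 (2026-08-16, refuter-cdisprove-stmt-AtomisticToContinuum-13481-0)

**No kill.  `CollisionRate` is "local virial theorem + propagation of local equilibrium, read on the bare collision
count"; a Lean refutation needs an in-probability LOWER (or upper) bound on the collision count `K_N[χ g]` of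
`N + 1 → ∞` deterministic spheres at fixed `σ` under an EVOLVED local Gibbs law — nothing of the kind exists in the
tree or in print, and the entropy inequality cannot import one from equilibrium (§3).**  Proved here (`sorry`-free):

* §1 LOAD-BEARING ANALYSIS.  (a) `collisionRateSwapped_holds`: the crux with its two limits SWAPPED
  (`∃ N₀ ∀ N ≥ N₀ ∃ r₀ ∀ r < r₀`, rest verbatim) is junk-TRUE — at fixed `N`, once `2r < ε_N` and
  `r ≤ 3σ³/(π(N+1)η₀)`, the cutoff read at a colliding particle sees the particle's own cone mass and kills every summand
  of `K_N`, and `B¹_r ≡ 0` on the hard-sphere domain; so the ORDER of the limits carries all the content, no estimate may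
  let `r` depend on `N`, and no counterexample can come from small `r` (landed as
  `Theorems/CollisionRate/Negative/SwappedOrderTrivial.lean`, p99212).  (b) `collisionRateTauNonpos_holds`: the
  hypothesis `0 < τ` is DECORATION — the `τ ≤ 0` statement (rest verbatim) is PROVED (Enskog side over a null window,
  collision side needs a pair in contact at time `0`, a `volume_contactSet`-null event; landed as
  `Theorems/CollisionRate/Negative/TauNonposTrivial.lean`, p101325).  (c) `CollisionRateWithoutCutoff` (def only,
  status in the docstring): the density cutoff `g = 0` on `[η₀, ∞)` is what keeps `Y` inside the band of
  `HsEosLowDensity` and is NOT independently droppable/refutable (hostage to DensityCap / DiluteSelfConsistency).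
* §2 LINE `Sketch` (card hazard-fairness-compensator; lead skeleton `Lines/Sketch.lean`, sha 2d03ea19bc62):
  **S1 `stub_hazardFair` is MISSTATED at fixed cell size `r'`** — the `G`-conditional hazard given (cells, exact
  velocities) uniformises positions inside macroscopic cells, the evolved local Gibbs law does not; Cauchy–Schwarz
  gives a strictly positive within-cell bias `O(r'²|∇log ρ|²)` that survives `N → ∞`, so `∀ η` fails at fixed `r'`.
  The arithmetic core is `twoSubcell_bias`; the repair (move `r'` under `η`: `∀ η δ ∀ C ∃ r'₁ ∀ r' < r'₁ ∃ N₀`) is a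
  WEAKENING (`fixedScale_imp_repaired`, schematic) that `CollisionRate_of` already tolerates (it `set`s `r'` after
  `η, δ, a, C`).  Evidence notes `stub_hazardFair.md` (analysis) and `stub_hazardFair_numerics.md` (kit j017678: the
  window-0 count over the cell-uniformised hazard equals the analytic Jensen ratio `∫ρ²/Σ_C(∫_Cρ)²/|C|` at `r' = 1/2, 1/4, 1/8`
  and is `N`-independent over `N+1 = 4096 … 262144`; control profile `A = 0` gives `1.00`).  S2–S5, H1–H3 and the rung-0 stubs
  (V, R0, S5|const, S3|const of reshape v4) read as consistently stated (S3 knowingly carries the crux's `∀ τ` over-reach, cf. §3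
  and the sibling's `TwoStreamTexture`).
* §3 WHY IT RESISTS / KILL TARGETS (docstring `resists`).
* §4 JUNK AUDIT — pointers only: `Y 0 = 0` (`EvenStressEnskog.deriv_hsExcessFreeEnergy_zero`) is harmless because
  `B¹_r = 0` where `ρ_r = 0` (`EvenStressEnskog.pairFunctional_eq_zero_of_mollifiedDensity_eq_zero`, any mark); the
  flow interface admits no junk inhabitant (`HardSphereFlow`: conull good set of genuine trajectories, law `≪`
  Liouville, `isProbabilityMeasure_localGibbsLaw` for `σ ≤ 1/2`); constants re-derived by three prover audits.
  SPECIFIC TO MARK 1: `Θ(1)(v, w) = π‖v − w‖` (`Theorems.CollisionRate.sphereMark_const_one`) is a FIRST absolute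
  moment, so — unlike the sibling's second-moment-blind `Ξ_P` (its §10) — the Enskog side here does see the shape of
  the local one-body velocity law; but it sees the SAME shape on both sides (B¹ is built from the actual particle
  pairs), so again only (i) the pair correlation AT CONTACT and (ii) sub-`r` texture of the velocity FIELD can break
  the crux.  Numerics on record support (i) at the percent level: equilibrium collision frequency = Enskog·Y_CS to
  1–2 % (ideator-2 toy j015881/j015963, this item), impulse rate with shear/temperature waves shows no non-equilibrium
  anomaly at 0.5–1.5 % (sibling j010547).
-/

noncomputable section

namespace Summit.AtomisticToContinuum.HydrodynamicLimit.Cruxes.CollisionRate.Disproof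

open MeasureTheory Filter Set
open scoped ENNReal
open Literature.MathematicalPhysics.KineticTheory Literature.Analysis.FluidPDE
open Summit.AtomisticToContinuum.HydrodynamicLimit.Theorems

/-! ## §1 Load-bearing analysis -/

/-- **(a) The crux with the two limits swapped** (`r → 0` BEFORE `N → ∞`): VERBATIM the route decl except that
`∃ r₀, 0 < r₀ ∧ ∀ r, 0 < r → r < r₀ → ∃ N₀, ∀ N, N₀ ≤ N →` becomes `∃ N₀, ∀ N, N₀ ≤ N → ∃ r₀, 0 < r₀ ∧ ∀ r, 0 < r → r < r₀ →`.
[folklore] -/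
def CollisionRateSwapped : Prop :=
  ∃ η₀ : ℝ, 0 < η₀ ∧ ∀ (a₀ θ₀ : Literature.MathematicalPhysics.KineticTheory.T3 → ℝ) (u₀ : Literature.MathematicalPhysics.KineticTheory.T3 → Literature.MathematicalPhysics.KineticTheory.V3), Continuous a₀ → Continuous θ₀ → Continuous u₀ → (∀ x, 0 < a₀ x) → (∀ x, 0 < θ₀ x) → ∃ σ₀ : ℝ, 0 < σ₀ ∧ ∀ σ : ℝ, 0 < σ → σ < σ₀ → ∀ Φ : (N : ℕ) → Literature.Analysis.FluidPDE.HardSphereFlow (Literature.Analysis.FluidPDE.Torus.geometry (Fin 3)) (Literature.MathematicalPhysics.KineticTheory.hsDiameter σ N) (N + 1), ∀ τ : ℝ, 0 < τ → ∀ χ : ℝ × Literature.MathematicalPhysics.KineticTheory.T3 → ℝ, Continuous χ → ∀ g : ℝ → ℝ, Continuous g → (∀ a, η₀ ≤ a → g a = 0) → ∀ η δ : ℝ, 0 < η → 0 < δ → ∃ N₀ : ℕ, ∀ N : ℕ, N₀ ≤ N → ∃ r₀ : ℝ, 0 < r₀ ∧ ∀ r : ℝ, 0 < r → r < r₀ →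 let ε := Literature.MathematicalPhysics.KineticTheory.hsDiameter σ N; let G : Literature.Analysis.FluidPDE.Geometry (Fin 3) Literature.MathematicalPhysics.KineticTheory.T3 := Literature.Analysis.FluidPDE.Torus.geometry (Fin 3); let γ : Literature.Analysis.FluidPDE.Config (N + 1) (Fin 3) Literature.MathematicalPhysics.KineticTheory.T3 → ℝ → Literature.Analysis.FluidPDE.Config (N + 1) (Fin 3) Literature.MathematicalPhysics.KineticTheory.T3 := fun z s => (Φ N).flow s z; let bx : Literature.MathematicalPhysics.KineticTheory.T3 → Literature.MathematicalPhysics.KineticTheory.T3 → ℝ := fun x y => 3 / (Real.pi * r ^ 3) * max (1 - Literature.Analysis.FluidPDE.Torus.euclidDist x y / r) 0; let ρm : Literature.Analysis.FluidPDE.Config (N + 1) (Fin 3) Literature.MathematicalPhysics.KineticTheory.T3 → ℝ → Literature.MathematicalPhysics.KineticTheory.T3 → ℝ := fun z s x₀ => ∫ q, bx q.1 x₀ ∂(Literature.Analysis.FluidPDE.empiricalMeasure (γ z s)); let B1 : Literature.Analysis.FluidPDE.Config (N + 1) (Fin 3) Literature.MathematicalPhysics.KineticTheory.T3 → ℝ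 → Literature.MathematicalPhysics.KineticTheory.T3 → ℝ := fun z s x₀ => ∫ p, bx p.1.1 x₀ * bx p.2.1 x₀ * (Real.pi * ‖p.1.2 - p.2.2‖) ∂((Literature.Analysis.FluidPDE.empiricalMeasure (γ z s)).prod (Literature.Analysis.FluidPDE.empiricalMeasure (γ z s))); let Kc : (Literature.Analysis.FluidPDE.Config (N + 1) (Fin 3) Literature.MathematicalPhysics.KineticTheory.T3 → ℝ → Fin (N + 1) → Fin (N + 1) → ℝ) → Literature.Analysis.FluidPDE.Config (N + 1) (Fin 3) Literature.MathematicalPhysics.KineticTheory.T3 → ℝ := fun F z => ε / (N + 1 : ℝ) * ∑ᶠ (s : ℝ) (_ : s ∈ Literature.Analysis.FluidPDE.collisionTimes G ε (γ z) ∩ Set.Icc 0 τ), ∑ i : Fin (N + 1), ∑ j : Fin (N + 1), (if i ≠ j ∧ ‖G.sepVec (γ z s i).1 (γ z s j).1‖ = ε then F z s i j else 0); let Y : ℝ → ℝ := fun a => 3 / (2 * Real.pi) * deriv Literature.MathematicalPhysics.KineticTheory.hsExcessFreeEnergy a; let D : Literature.Analysis.FluidPDE.Config (N + 1) (Fin 3)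 Literature.MathematicalPhysics.KineticTheory.T3 → ℝ := fun z => Kc (fun z s i _ => χ (s, (γ z s i).1) * g (σ ^ 3 * ρm z s (γ z s i).1)) z - σ ^ 3 * ∫ s in Set.Icc (0 : ℝ) τ, ∫ x : Literature.MathematicalPhysics.KineticTheory.T3, χ (s, x) * g (σ ^ 3 * ρm z s x) * Y (σ ^ 3 * ρm z s x) * B1 z s x; Literature.MathematicalPhysics.KineticTheory.localGibbsLaw σ a₀ u₀ θ₀ N (Φ N) {z | η < |D z|} ≤ ENNReal.ofReal δ

/-- **Both sides of the crux vanish at small `r` for fixed `N`** (constant-mark specialisation of the sibling's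
`EvenStressEnskog.deviation_eq_zero_of_small_r`, `Y := contactValue`): once `r ≤ 1`, `2r < ε_N` and
`r ≤ 3σ³/(π(N+1)η₀)`, `evenStat σ N Φ τ χ g 1 r z = 0` on every good orbit. [folklore] -/
theorem evenStat_one_eq_zero_of_small_r {N : ℕ} {σ η₀ r : ℝ} (hσ : 0 < σ) (hη₀ : 0 < η₀) (hr : 0 < r)
    (hr1 : r ≤ 1) (hrε : 2 * r < hsDiameter σ N) (hrN : r ≤ 3 * σ ^ 3 / (Real.pi * (N + 1 : ℝ) * η₀))
    (Φ : HardSphereFlow (Torus.geometry (Fin 3)) (hsDiameter σ N) (N + 1)) (τ : ℝ) (χ : ℝ × T3 → ℝ)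
    (g : ℝ → ℝ) (hg0 : ∀ a, η₀ ≤ a → g a = 0) {z : Config (N + 1) (Fin 3) T3} (hz : z ∈ Φ.good) :
    evenStat σ N Φ τ χ g (fun _ => 1) r z = 0 := by
  have h := EvenStressEnskog.deviation_eq_zero_of_small_r hσ hη₀ hr hr1 hrε hrN Φ τ χ g hg0 contactValue
    (fun _ => (1 : ℝ)) hz
  dsimp only [evenStat, Literature.MathematicalPhysics.KineticTheory.collisionSum, enskogRate, pairFunctional,
    mollDensity, coneKernel, sphereMark]
  exact h

/-- **(a) `CollisionRateSwapped` HOLDS (junk-true).**  Witnesses `η₀ := 1`, `σ₀ := 1`, `N₀ := 0`,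
`r₀(N) := min (min 1 (ε_N/2)) (3σ³/(π(N+1)))`; the deviation event lies in the Liouville-null bad set of the flow.
MORAL: any proof must use the `N`-before-`r` order (no `r`-uniform-in-`N` shortcut exists, the self-term
`3σ³/(πr³(N+1))` must be absorbed before `r → 0`); any refutation must keep `r` fixed while `N → ∞`.  Landed as
`Theorems.CollisionRate.collisionRate_swappedOrder` (p99212). [folklore] -/
theorem collisionRateSwapped_holds : CollisionRateSwapped := by
  unfold CollisionRateSwapped
  simp only [CollisionRate.stat_eq_evenStat_one]
  refine ⟨1, one_pos, fun a₀ θ₀ u₀ _ _ _ _ _ => ⟨1, one_pos, ?_⟩⟩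
  intro σ hσ _ Φ τ _ χ _ g _ hg0 η δ hη _
  refine ⟨0, fun N _ => ?_⟩
  have hεpos : 0 < hsDiameter σ N := hsDiameter_pos hσ N
  have hq : 0 < 3 * σ ^ 3 / (Real.pi * (N + 1 : ℝ) * 1) := by positivity
  refine ⟨min (min 1 (hsDiameter σ N / 2)) (3 * σ ^ 3 / (Real.pi * (N + 1 : ℝ) * 1)),
    lt_min (lt_min one_pos (half_pos hεpos)) hq, fun r hr hrlt => ?_⟩
  have hr1 : r ≤ 1 := (hrlt.le.trans (min_le_left _ _)).trans (min_le_left _ _)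
  have hrε : 2 * r < hsDiameter σ N := by
    have := (hrlt.trans_le (min_le_left _ _)).trans_le (min_le_right _ _)
    linarith
  have hrN : r ≤ 3 * σ ^ 3 / (Real.pi * (N + 1 : ℝ) * 1) := hrlt.le.trans (min_le_right _ _)
  have hzero : ∀ z ∈ (Φ N).good, evenStat σ N (Φ N) τ χ g (fun _ => 1) r z = 0 := fun z hz =>
    evenStat_one_eq_zero_of_small_r hσ one_pos hr hr1 hrε hrN (Φ N) τ χ g hg0 hz
  calc localGibbsLaw σ a₀ u₀ θ₀ N (Φ N) {z | η < |evenStat σ N (Φ N) τ χ g (fun _ => 1) r z|}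
      ≤ localGibbsLaw σ a₀ u₀ θ₀ N (Φ N) (Φ N).goodᶜ := by
        refine measure_mono fun z hz' hzg => ?_
        have h0 := hzero z hzg
        simp only [Set.mem_setOf_eq] at hz'
        rw [h0, abs_zero] at hz'
        exact absurd hz' (not_lt.mpr hη.le)
    _ = 0 := EvenStressEnskog.localGibbsLaw_compl_good (Φ N)
    _ ≤ ENNReal.ofReal δ := zero_le

/-- **(b) Hypothesis `0 < τ` is decoration.**  The crux with `0 < τ` replaced by `τ ≤ 0` (rest verbatim).  PROVED
below (`collisionRateTauNonpos_holds`): for `τ ≤ 0` the window `Icc 0 τ ⊆ {0}` is Lebesgue-null (Enskog side `0`,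
`setIntegral_measure_zero`) and a collision time in it means that the INITIAL datum lies on a contact set (good orbits
have `Φ_0 z = z`), a `volume_contactSet`-null event, null for the local Gibbs law.  Consequence: dropping or mutating
`0 < τ` changes nothing; no refutation from degenerate horizons. [folklore] -/
def CollisionRateTauNonpos : Prop :=
  ∃ η₀ : ℝ, 0 < η₀ ∧ ∀ (a₀ θ₀ : Literature.MathematicalPhysics.KineticTheory.T3 → ℝ) (u₀ : Literature.MathematicalPhysics.KineticTheory.T3 → Literature.MathematicalPhysics.KineticTheory.V3), Continuous a₀ → Continuous θ₀ → Continuous u₀ → (∀ x, 0 < a₀ x) → (∀ x, 0 < θ₀ x) → ∃ σ₀ : ℝ, 0 < σ₀ ∧ ∀ σ : ℝ, 0 < σ → σ < σ₀ → ∀ Φ : (N : ℕ) → Literature.Analysis.FluidPDE.HardSphereFlow (Literature.Analysis.FluidPDE.Torus.geometry (Fin 3)) (Literature.MathematicalPhysics.KineticTheory.hsDiameter σ N) (N + 1), ∀ τ : ℝ, τ ≤ 0 → ∀ χ : ℝ × Literature.MathematicalPhysics.KineticTheory.T3 → ℝ, Continuous χ → ∀ g : ℝ → ℝ, Continuous g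 → (∀ a, η₀ ≤ a → g a = 0) → ∀ η δ : ℝ, 0 < η → 0 < δ → ∃ r₀ : ℝ, 0 < r₀ ∧ ∀ r : ℝ, 0 < r → r < r₀ → ∃ N₀ : ℕ, ∀ N : ℕ, N₀ ≤ N → let ε := Literature.MathematicalPhysics.KineticTheory.hsDiameter σ N; let G : Literature.Analysis.FluidPDE.Geometry (Fin 3) Literature.MathematicalPhysics.KineticTheory.T3 := Literature.Analysis.FluidPDE.Torus.geometry (Fin 3); let γ : Literature.Analysis.FluidPDE.Config (N + 1) (Fin 3) Literature.MathematicalPhysics.KineticTheory.T3 → ℝ → Literature.Analysis.FluidPDE.Config (N + 1) (Fin 3) Literature.MathematicalPhysics.KineticTheory.T3 := fun z s => (Φ N).flow s z; let bx : Literature.MathematicalPhysics.KineticTheory.T3 → Literature.MathematicalPhysics.KineticTheory.T3 → ℝ := fun x y => 3 / (Real.pi * r ^ 3) * max (1 - Literature.Analysis.FluidPDE.Torus.euclidDist x y / r) 0; let ρm : Literature.Analysis.FluidPDE.Config (N + 1) (Fin 3) Literature.MathematicalPhysics.KineticTheory.T3 → ℝ → Literature.MathematicalPhysics.KineticTheory.T3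 → ℝ := fun z s x₀ => ∫ q, bx q.1 x₀ ∂(Literature.Analysis.FluidPDE.empiricalMeasure (γ z s)); let B1 : Literature.Analysis.FluidPDE.Config (N + 1) (Fin 3) Literature.MathematicalPhysics.KineticTheory.T3 → ℝ → Literature.MathematicalPhysics.KineticTheory.T3 → ℝ := fun z s x₀ => ∫ p, bx p.1.1 x₀ * bx p.2.1 x₀ * (Real.pi * ‖p.1.2 - p.2.2‖) ∂((Literature.Analysis.FluidPDE.empiricalMeasure (γ z s)).prod (Literature.Analysis.FluidPDE.empiricalMeasure (γ z s))); let Kc : (Literature.Analysis.FluidPDE.Config (N + 1) (Fin 3) Literature.MathematicalPhysics.KineticTheory.T3 → ℝ → Fin (N + 1) → Fin (N + 1) → ℝ) → Literature.Analysis.FluidPDE.Config (N + 1) (Fin 3) Literature.MathematicalPhysics.KineticTheory.T3 → ℝ := fun F z => ε / (N + 1 : ℝ) * ∑ᶠ (s : ℝ) (_ : s ∈ Literature.Analysis.FluidPDE.collisionTimes G ε (γ z) ∩ Set.Icc 0 τ), ∑ i : Fin (N + 1), ∑ j : Fin (N + 1), (if i ≠ j ∧ ‖G.sepVec (γ z s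 i).1 (γ z s j).1‖ = ε then F z s i j else 0); let Y : ℝ → ℝ := fun a => 3 / (2 * Real.pi) * deriv Literature.MathematicalPhysics.KineticTheory.hsExcessFreeEnergy a; let D : Literature.Analysis.FluidPDE.Config (N + 1) (Fin 3) Literature.MathematicalPhysics.KineticTheory.T3 → ℝ := fun z => Kc (fun z s i _ => χ (s, (γ z s i).1) * g (σ ^ 3 * ρm z s (γ z s i).1)) z - σ ^ 3 * ∫ s in Set.Icc (0 : ℝ) τ, ∫ x : Literature.MathematicalPhysics.KineticTheory.T3, χ (s, x) * g (σ ^ 3 * ρm z s x) * Y (σ ^ 3 * ρm z s x) * B1 z s x; Literature.MathematicalPhysics.KineticTheory.localGibbsLaw σ a₀ u₀ θ₀ N (Φ N) {z | η < |D z|} ≤ ENNReal.ofReal δ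


/-- The set of initial data with some pair in contact is Lebesgue-null (finite union of contact sets). [folklore] -/
theorem volume_setOf_exists_mem_contactSet {N : ℕ} {ε : ℝ} (hε : ε ≠ 0) :
    volume {z : Config (N + 1) (Fin 3) T3 |
      ∃ i j : Fin (N + 1), i ≠ j ∧ z ∈ contactSet (Torus.geometry (Fin 3)) (N + 1) ε i j} = 0 := by
  have hsub : {z : Config (N + 1) (Fin 3) T3 |
        ∃ i j : Fin (N + 1), i ≠ j ∧ z ∈ contactSet (Torus.geometry (Fin 3)) (N + 1) ε i j} ⊆
      ⋃ i : Fin (N + 1), ⋃ j : Fin (N + 1),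
        (if i ≠ j then contactSet (Torus.geometry (Fin 3)) (N + 1) ε i j else ∅) := by
    intro z hz
    rcases hz with ⟨i, j, hij, hz⟩
    simp only [Set.mem_iUnion]
    exact ⟨i, j, by simp [hij, hz]⟩
  refine measure_mono_null hsub ?_
  refine (measure_iUnion_null_iff).2 fun i => (measure_iUnion_null_iff).2 fun j => ?_
  split_ifs with hij
  · exact volume_contactSet hε hij
  · exact measure_empty

/-- … hence null for every local Gibbs law (`≪ liouville ≪ volume`). [folklore] -/
theorem localGibbsLaw_setOf_exists_mem_contactSet {σ : ℝ} (hσ : 0 < σ) {a₀ θ₀ : T3 → ℝ} {u₀ : T3 → V3} {N : ℕ}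
    (Φ : HardSphereFlow (Torus.geometry (Fin 3)) (hsDiameter σ N) (N + 1)) :
    localGibbsLaw σ a₀ u₀ θ₀ N Φ {z : Config (N + 1) (Fin 3) T3 |
      ∃ i j : Fin (N + 1), i ≠ j ∧ z ∈ contactSet (Torus.geometry (Fin 3)) (N + 1) (hsDiameter σ N) i j} = 0 := by
  unfold localGibbsLaw particleLaw
  refine withDensity_absolutelyContinuous _ _ ?_
  unfold liouville
  exact (Measure.absolutelyContinuous_of_le Measure.restrict_le_self)
    (volume_setOf_exists_mem_contactSet (hsDiameter_pos hσ N).ne')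

/-- On a good orbit with no pair in contact at time `0`, the constant-mark statistic over a degenerate horizon
`τ ≤ 0` vanishes. [folklore] -/
theorem evenStat_one_eq_zero_of_tau_nonpos {N : ℕ} {σ τ : ℝ} (hτ : τ ≤ 0)
    (Φ : HardSphereFlow (Torus.geometry (Fin 3)) (hsDiameter σ N) (N + 1)) (χ : ℝ × T3 → ℝ) (g : ℝ → ℝ) (r : ℝ)
    {z : Config (N + 1) (Fin 3) T3} (hz : z ∈ Φ.good)
    (hz0 : ¬ ∃ i j : Fin (N + 1), i ≠ j ∧ z ∈ contactSet (Torus.geometry (Fin 3)) (N + 1) (hsDiameter σ N) i j) :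
    evenStat σ N Φ τ χ g (fun _ => 1) r z = 0 := by
  have hvol : (volume : Measure ℝ) (Set.Icc 0 τ) = 0 := by
    rw [Real.volume_Icc]
    exact ENNReal.ofReal_eq_zero.2 (by linarith)
  have hint : ∫ s in Set.Icc (0 : ℝ) τ, enskogRate σ N χ g (fun _ => 1) r s (Φ.flow s z) = 0 :=
    setIntegral_measure_zero _ hvol
  have hS : collisionTimes (Torus.geometry (Fin 3)) (hsDiameter σ N) (fun s => Φ.flow s z) ∩ Set.Icc 0 τ = ∅ := by
    ext s
    simp only [Set.mem_inter_iff, Set.mem_Icc, Set.mem_empty_iff_false, iff_false, not_and]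
    intro hs h0 hsτ
    have hs0 : s = 0 := le_antisymm (hsτ.trans hτ) h0
    subst hs0
    rcases hs with ⟨i, j, hij, hc⟩
    change Φ.flow 0 z ∈ _ at hc
    rw [Φ.flow_zero z hz] at hc
    exact hz0 ⟨i, j, hij, hc⟩
  rw [evenStat_def, hint, mul_zero, sub_zero]
  dsimp only [Literature.MathematicalPhysics.KineticTheory.collisionSum]
  rw [hS]
  simp

/-- **(b) `CollisionRateTauNonpos` HOLDS: `0 < τ` is decoration.**  Witnesses `η₀ := 1`, `σ₀ := 1`, `r₀ := 1`,
`N₀ := 0`; the deviation event lies in the null set `goodᶜ ∪ {some pair in contact at time 0}`.  Landed as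
`Theorems.CollisionRate.collisionRate_tauNonpos` (p101325). [folklore] -/
theorem collisionRateTauNonpos_holds : CollisionRateTauNonpos := by
  unfold CollisionRateTauNonpos
  simp only [CollisionRate.stat_eq_evenStat_one]
  refine ⟨1, one_pos, fun a₀ θ₀ u₀ _ _ _ _ _ => ⟨1, one_pos, ?_⟩⟩
  intro σ hσ _ Φ τ hτ χ _ g _ _ η δ hη _
  refine ⟨1, one_pos, fun r _ _ => ⟨0, fun N _ => ?_⟩⟩
  set B : Set (Config (N + 1) (Fin 3) T3) := {z | ∃ i j : Fin (N + 1), i ≠ j ∧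
    z ∈ contactSet (Torus.geometry (Fin 3)) (N + 1) (hsDiameter σ N) i j} with hB
  have hzero : ∀ z ∈ (Φ N).good, z ∉ B → evenStat σ N (Φ N) τ χ g (fun _ => 1) r z = 0 := fun z hz hzB =>
    evenStat_one_eq_zero_of_tau_nonpos hτ (Φ N) χ g r hz hzB
  calc localGibbsLaw σ a₀ u₀ θ₀ N (Φ N) {z | η < |evenStat σ N (Φ N) τ χ g (fun _ => 1) r z|}
      ≤ localGibbsLaw σ a₀ u₀ θ₀ N (Φ N) ((Φ N).goodᶜ ∪ B) := by
        refine measure_mono fun z hz' => ?_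
        by_contra hzu
        simp only [Set.mem_union, Set.mem_compl_iff, not_or, not_not] at hzu
        have h0 := hzero z hzu.1 hzu.2
        simp only [Set.mem_setOf_eq] at hz'
        rw [h0, abs_zero] at hz'
        exact absurd hz' (not_lt.mpr hη.le)
    _ ≤ localGibbsLaw σ a₀ u₀ θ₀ N (Φ N) (Φ N).goodᶜ + localGibbsLaw σ a₀ u₀ θ₀ N (Φ N) B :=
        measure_union_le _ _
    _ = 0 := by
        rw [EvenStressEnskog.localGibbsLaw_compl_good (Φ N), hB,
          localGibbsLaw_setOf_exists_mem_contactSet hσ (Φ N), add_zero]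
    _ ≤ ENNReal.ofReal δ := zero_le

/-- **(c) The density cutoff.**  The crux WITHOUT `∀ a, η₀ ≤ a → g a = 0` (then `η₀` is idle and is dropped; `g`
continuous and bounded instead; rest verbatim).  STATUS: UNDECIDED and not cheaply decidable.  The cutoff does two
jobs: it keeps the contact value `Y = (3/2π)·deriv hsExcessFreeEnergy` inside the band `[0, η₀)` where
`HsEosLowDensity` (stmt-0768, PROVED) makes it the analytic `F′` — outside, `Y` is `deriv`-junk (possibly `0` at a
kink, and `Real.log 0 = 0` beyond close packing) — and it makes the statement independent of overcompression.  Without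
it the statement asserts the Enskog law at whatever reduced densities the evolved empirical field reaches; refuting it
needs either an overcompression event of positive limiting probability (the content of DensityCap stmt-13082 /
DiluteSelfConsistency stmt-3091, open) or the same collision-count lower bound as the crux.  Provers: every use of
`Y` must stay on the OPEN band via the `F` of `HsEosLowDensity` (`EvenStressEnskog.not_continuousWithinAt_contactValue`:
`Y` is not even right-continuous at `0`). [folklore] -/
def CollisionRateWithoutCutoff : Prop :=
  ∀ (a₀ θ₀ : Literature.MathematicalPhysics.KineticTheory.T3 → ℝ) (u₀ : Literature.MathematicalPhysics.KineticTheory.T3 → Literature.MathematicalPhysics.KineticTheory.V3), Continuous a₀ → Continuous θ₀ → Continuous u₀ → (∀ x, 0 < a₀ x) → (∀ x, 0 < θ₀ x) → ∃ σ₀ : ℝ, 0 < σ₀ ∧ ∀ σ : ℝ, 0 < σ → σ < σ₀ → ∀ Φ : (N : ℕ) → Literature.Analysis.FluidPDE.HardSphereFlow (Literature.Analysis.FluidPDE.Torus.geometry (Fin 3)) (Literature.MathematicalPhysics.KineticTheory.hsDiameter σ N) (N + 1), ∀ τ : ℝ, 0 < τ → ∀ χ : ℝ × Literature.MathematicalPhysics.KineticTheory.T3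 → ℝ, Continuous χ → ∀ g : ℝ → ℝ, Continuous g → (∃ Cg : ℝ, ∀ a, |g a| ≤ Cg) → ∀ η δ : ℝ, 0 < η → 0 < δ → ∃ r₀ : ℝ, 0 < r₀ ∧ ∀ r : ℝ, 0 < r → r < r₀ → ∃ N₀ : ℕ, ∀ N : ℕ, N₀ ≤ N → let ε := Literature.MathematicalPhysics.KineticTheory.hsDiameter σ N; let G : Literature.Analysis.FluidPDE.Geometry (Fin 3) Literature.MathematicalPhysics.KineticTheory.T3 := Literature.Analysis.FluidPDE.Torus.geometry (Fin 3); let γ : Literature.Analysis.FluidPDE.Config (N + 1) (Fin 3) Literature.MathematicalPhysics.KineticTheory.T3 → ℝ → Literature.Analysis.FluidPDE.Config (N + 1) (Fin 3) Literature.MathematicalPhysics.KineticTheory.T3 := fun z s => (Φ N).flow s z; let bx : Literature.MathematicalPhysics.KineticTheory.T3 → Literature.MathematicalPhysics.KineticTheory.T3 → ℝ := fun x y => 3 / (Real.pi * r ^ 3) * max (1 - Literature.Analysis.FluidPDE.Torus.euclidDist x y / r) 0; let ρm : Literature.Analysis.FluidPDE.Config (N + 1) (Fin 3) Literature.MathematicalPhysics.KineticTheory.T3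 → ℝ → Literature.MathematicalPhysics.KineticTheory.T3 → ℝ := fun z s x₀ => ∫ q, bx q.1 x₀ ∂(Literature.Analysis.FluidPDE.empiricalMeasure (γ z s)); let B1 : Literature.Analysis.FluidPDE.Config (N + 1) (Fin 3) Literature.MathematicalPhysics.KineticTheory.T3 → ℝ → Literature.MathematicalPhysics.KineticTheory.T3 → ℝ := fun z s x₀ => ∫ p, bx p.1.1 x₀ * bx p.2.1 x₀ * (Real.pi * ‖p.1.2 - p.2.2‖) ∂((Literature.Analysis.FluidPDE.empiricalMeasure (γ z s)).prod (Literature.Analysis.FluidPDE.empiricalMeasure (γ z s))); let Kc : (Literature.Analysis.FluidPDE.Config (N + 1) (Fin 3) Literature.MathematicalPhysics.KineticTheory.T3 → ℝ → Fin (N + 1) → Fin (N + 1) → ℝ) → Literature.Analysis.FluidPDE.Config (N + 1) (Fin 3) Literature.MathematicalPhysics.KineticTheory.T3 → ℝ := fun F z => ε / (N + 1 : ℝ) * ∑ᶠ (s : ℝ) (_ : s ∈ Literature.Analysis.FluidPDE.collisionTimes G ε (γ z) ∩ Set.Icc 0 τ), ∑ i : Fin (N + 1), ∑ j : Fin (N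 + 1), (if i ≠ j ∧ ‖G.sepVec (γ z s i).1 (γ z s j).1‖ = ε then F z s i j else 0); let Y : ℝ → ℝ := fun a => 3 / (2 * Real.pi) * deriv Literature.MathematicalPhysics.KineticTheory.hsExcessFreeEnergy a; let D : Literature.Analysis.FluidPDE.Config (N + 1) (Fin 3) Literature.MathematicalPhysics.KineticTheory.T3 → ℝ := fun z => Kc (fun z s i _ => χ (s, (γ z s i).1) * g (σ ^ 3 * ρm z s (γ z s i).1)) z - σ ^ 3 * ∫ s in Set.Icc (0 : ℝ) τ, ∫ x : Literature.MathematicalPhysics.KineticTheory.T3, χ (s, x) * g (σ ^ 3 * ρm z s x) * Y (σ ^ 3 * ρm z s x) * B1 z s x; Literature.MathematicalPhysics.KineticTheory.localGibbsLaw σ a₀ u₀ θ₀ N (Φ N) {z | η < |D z|} ≤ ENNReal.ofReal δ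

/-! ## §2 Line `Sketch` — stub audit (targets: none stuck yet; `stub_hazardFair` misstated) -/

/-- **The arithmetic core of the S1 bias** (cartoon of `stub_hazardFair`'s defect at fixed `r'`).  Split a cell of
mean density `ρ` into two halves of densities `ρ(1 ± A)`: the true pair-collision rate is proportional to the mean of
the SQUARED sub-densities, the `G`-conditional hazard given the cell (positions uniformised over the cell) to the
squared MEAN; the former is strictly larger as soon as `A ≠ 0` (relative gap `A²`; for a smooth profile
`A² ↦ Var_C(ρ)/ρ̄² = O(r'²|∇log ρ|²)`).  NUMERICS (kit j017678, static window-0 computation, positions i.i.d. with density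
`1 + A cos(2πx₁)`, Maxwellian velocities, free-flight encounter count `T` over `w = ½` mean free time vs the cell-uniformised
static hazard `P = (σ³w/ε)Σ_i staticHazard`, 3 replicas): `T/P` at `(r' = ½, ¼, ⅛)` for `A = ½`: `1.119(23), 1.008(16), 0.996(19)`
[`N+1 = 4096`]; `1.126(7), 1.019(4), 1.003(5)` [`32768`]; `1.129(1), 1.025(1), 1.008(2)` [`110592`]; `1.127(2), 1.024(2), 1.008(2)`
[`262144`] against the analytic Jensen ratios `1.1250, 1.0215, 1.0056`; for `A = ¼`: `1.031(1), 1.006(1), 1.001(1)` [`262144`] vs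
`1.0312, 1.0058, 1.0015`; control `A = 0`: `1.001–1.005` at every size (normalisation `π‖v−w‖`, ordered pairs, `r'⁻³` confirmed).
The bias is `N`-independent: at fixed `r'` the stub's `∀ η … ∃ N₀` cannot hold under a non-uniform profile. [folklore] -/
theorem twoSubcell_bias (ρ A : ℝ) (hρ : ρ ≠ 0) (hA : A ≠ 0) :
    ρ ^ 2 < ((ρ * (1 + A)) ^ 2 + (ρ * (1 - A)) ^ 2) / 2 := by
  have h1 : ((ρ * (1 + A)) ^ 2 + (ρ * (1 - A)) ^ 2) / 2 = ρ ^ 2 + (ρ * A) ^ 2 := by ring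
  rw [h1]
  have h2 : 0 < (ρ * A) ^ 2 := by positivity
  linarith

/-- **Discrete Cauchy–Schwarz form of the same gap** for `m` sub-cells: `(Σ ρ_i)² ≤ m · Σ ρ_i²`, i.e. the
uniformised prediction `m · ρ̄²` never exceeds the true `Σ ρ_i²` (equality iff all `ρ_i` equal — the only case in
which the fixed-`r'` S1 can hold under a non-equilibrium law). [folklore] -/
theorem uniformised_le_true {m : ℕ} (ρ : Fin m → ℝ) :
    (∑ i, ρ i) ^ 2 ≤ (m : ℝ) * ∑ i, ρ i ^ 2 := by
  have h := sq_sum_le_card_mul_sum_sq (s := (Finset.univ : Finset (Fin m))) (f := ρ)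
  simpa using h

/-- **The repair of S1 is a weakening** (schematic, over an abstract deviation predicate `P r' η N` standing for
"`P_{LG}(|WS(h,D) − WS(h,κ)| > η) ≤ δ` at cell size `r'` and particle number `N`"): the filed fixed-scale shape
implies the repaired shape in which the cell size is chosen after the tolerance.  So the lead loses nothing by adopting
`∀ η δ ∀ C ∃ r'₁ ∀ r' < r'₁ ∃ N₀` — and `CollisionRate_of` composes unchanged because it `set`s `r'` after `η, δ, a, C`
(take `r' := min (min r'₃ r'₄) r'₁ / 2`). [folklore] -/
theorem fixedScale_imp_repaired {P : ℝ → ℝ → ℕ → Prop}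
    (h : ∀ r' : ℝ, 0 < r' → ∀ η : ℝ, 0 < η → ∃ N₀ : ℕ, ∀ N : ℕ, N₀ ≤ N → P r' η N) :
    ∀ η : ℝ, 0 < η → ∃ r'₁ : ℝ, 0 < r'₁ ∧ ∀ r' : ℝ, 0 < r' → r' < r'₁ → ∃ N₀ : ℕ, ∀ N : ℕ, N₀ ≤ N → P r' η N :=
  fun η hη => ⟨1, one_pos, fun r' hr' _ => h r' hr' η hη⟩

/-! ## §3 Why it resists; kill targets -/

/-- **WHY NO `¬ CollisionRate` IS REACHABLE (and what would be).**
1. SHAPE OF A KILL.  `¬S` = for some continuous positive profiles, EVERY `σ₀` admits `σ < σ₀`, a flow family, `τ, χ, g`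
   (cutoff at the prover's `η₀` — adversarially small), `η, δ` such that for all small `r` and infinitely many `N`:
   `P_{LG}(|K_N[χ g(σ³ρ_r)] − σ³∫∫χ g Y B¹_r| > η) > δ`.  Both functionals are honest on the good set (finite collision
   sets, bounded integrands), the law is a probability measure `≪` Liouville and flows exist (Alexander), so `¬S` would
   be unconditional — but it needs the LIMITING BEHAVIOUR of the collision COUNT of the deterministic `(N+1)`-sphere
   flow under an EVOLVED non-equilibrium law.  No lower or upper bound of that kind (at fixed `σ`, macroscopic times)
   exists in the tree or in print; the validity theorems (Lanford, GST2013, BGSS, Deng–Hani–Ma) are dilute and short.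
2. THE ENTROPY ROUTE IS CLOSED.  `H(LG | G) = O(N)` transfers to `LG` only events that are SUPER-exponentially rare
   under the invariant law `G`.  But under `G` (canonical positions × Maxwellian product velocities) the collision
   count has only EXPONENTIALLY small lower AND upper tails at relative scale `ε′`: cooling the velocity product by a
   factor `(1−ε′)²` costs `e^{−Θ(N)}` and rescales every trajectory in time (count `∝ √θ`); clumping the density at
   the macroscopic scale costs `e^{−N·I(profile)}` and raises the count by Jensen.  So neither a lower nor an upper
   bound on `K_N[1]` can be imported from equilibrium — consistently with the fact that the TRUE non-equilibrium count
   (`∝ ∫ρ²Y`) differs from the equilibrium one at order 1.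
3. PHYSICS.  At fixed small `φ` the state relaxes to local equilibrium on the kinetic time `ε_N/σ³ → 0`; in local
   equilibrium the contact pair correlation IS `Y(φ_loc)` (local virial theorem) and incoming pairs are uncorrelated;
   known non-equilibrium contact anomalies (shear-induced anisotropy of `g(σ⁺)`, Lutsko 1996/2001; ring/shielding
   corrections) are `O(Kn)` or corrections to TRANSPORT coefficients, invisible at Euler scaling.  Numerics on record
   agree to 1–2 %.
4. KILL TARGETS (what WOULD refute the crux as filed).  (a) An Euler-scale anomaly of the collision COUNT under local
   Gibbs data (not of the impulse sum — that is the sibling's target; a state with correct collisional pressure but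
   anomalous count kills THIS crux and not 13079, and vice versa).  (b) HIDDEN MESOSCALE COMPACTNESS: a post-singularity
   limit with a persistent two-stream (Young-measure) velocity texture below every fixed `r` makes the Enskog side count
   inter-stream pairs that never meet (`EvenStressEnskog.pairFunctionalP_two_stream` at the sibling's marks; at mark 1
   the inter-stream term is `2W₁W₂π‖u₁ − u₂‖ > 0` by `sphereMark_const_one`) while the collision side is blind to them —
   the crux fails surely there for EVERY `r`, although kinetic local equilibrium and the contact value can hold exactly.
   Pre-shock no such texture forms from smooth profiles; post-shock it is open (wild/measure-valued Euler).  Hence the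
   standing RECOMMENDATION (prover audits A6, sibling §12): the conforming statement restricts to `τ < T` under the
   conjunct's hypotheses; as filed (`∀ τ`) the crux embeds sub-`r` strong compactness of the empirical velocity field
   for all times.  (c) Overcompression is NOT a target (the cutoff `g` makes the statement vacuous there).
5. LOAD-BEARING HYPOTHESES, summary: limit order (§1a, proved); cutoff (§1c, undecidable alone); `0 < τ` decoration
   (§1b); `0 < a₀` only feeds `isProbabilityMeasure_localGibbsLaw`; continuity of `χ, g` only feeds boundedness on
   compacts; `σ < σ₀(profiles)` is where local well-preparedness lives (no refutation from large `σ`: the cutoff empties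
   the statement at high density). [folklore] -/
theorem resists : True := trivial

end Summit.AtomisticToContinuum.HydrodynamicLimit.Cruxes.CollisionRate.Disproof

end
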